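import Summits.Schanuel.Schanuel.Theses.DiophantineDichotomy

/-!
# β-expansion roots: bounded-height algebraic approximations to a real base `1 < x < 4`
(tool file for the negative lemmas on crux `EPiSimultaneousType`, stmt-Schanuel-6118, route
DiophantineDichotomy; cdisprove cycle 2)

The greedy expansion `1 = Σ_{j<n} d_j x^{−(j+1)} + r_n x^{−n}` (`r_0 = 1`, `r_{j+1} = {x r_j}`,
`d_j = ⌊x r_j⌋ ∈ {0,…,⌊x⌋}`, `0 ≤ r_n < 1`) makes `x` an approximate root of the height-`⌊x⌋`
integer polynomial `P_n = Xⁿ − Σ_{j<n} d_j X^{n−1−j}`; since `F_n(y) = 1 − Σ d_j y^{−(j+1)}`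
increases with slope `≥ d_0/(xy) ≥ 1/x²` on `(0, x]` and `0 ≤ F_n(x) < x^{−n}`, the IVT gives a real
ROOT `ρ` of `P_n` with `x − x²/xⁿ ≤ ρ ≤ x`. Main export: `EPiSimultaneousType.exists_clause_three_near`
— for `1 < x < 4`, `n ≥ 2`: a root of a non-zero `P ∈ ℤ[X]`, `deg P ≤ n`, naive height `≤ 3`,
within `x²/xⁿ` of `x`, in the exact shape of the crux's per-coordinate clause; and
`sq_div_pow_le` (`x²/xⁿ ≤ 16 e^{−n}` for `e ≤ x < 4`). Used by `Negative/BoundedHeightHalf.lean`.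

The file is definition-free: the remainder sequence `r` is a hypothesis (`r 0 = 1`,
`r (j+1) = fract (x · r j)`), instantiated by `Nat.rec` in the export.
Everything is proved; axioms `propext`, `Classical.choice`, `Quot.sound`.
-/

set_option linter.dupNamespace false

noncomputable section

namespace Summit.Schanuel.Schanuel.Theorems

open Polynomial

namespace EPiSimultaneousType

section Beta

variable {x : ℝ} {r : ℕ → ℝ}

/-- The recursion `r_{j+1} = x r_j − d_j`, `d_j = ⌊x r_j⌋`. [folklore] -/
theorem beta_succ (hrs : ∀ j, r (j + 1) = Int.fract (x * r j)) (j : ℕ) :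
    r (j + 1) = x * r j - ⌊x * r j⌋ := by
  rw [hrs, ← Int.self_sub_floor]

/-- `0 ≤ r_j`. [folklore] -/
theorem beta_nonneg (hr0 : r 0 = 1) (hrs : ∀ j, r (j + 1) = Int.fract (x * r j)) :
    ∀ j, 0 ≤ r j
  | 0 => by rw [hr0]; norm_num
  | j + 1 => by rw [hrs]; exact Int.fract_nonneg _

/-- `r_j ≤ 1`. [folklore] -/
theorem beta_le_one (hr0 : r 0 = 1) (hrs : ∀ j, r (j + 1) = Int.fract (x * r j)) :
    ∀ j, r j ≤ 1
  | 0 => hr0.le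
  | j + 1 => by rw [hrs]; exact (Int.fract_lt_one _).le

/-- `r_j < 1` for `j ≥ 1`. [folklore] -/
theorem beta_succ_lt_one (hrs : ∀ j, r (j + 1) = Int.fract (x * r j)) (j : ℕ) : r (j + 1) < 1 := by
  rw [hrs]; exact Int.fract_lt_one _

/-- Digits are in `[0, ⌊x⌋]` for `x ≥ 0`. [folklore] -/
theorem betaDigit_mem (hx : 0 ≤ x) (hr0 : r 0 = 1) (hrs : ∀ j, r (j + 1) = Int.fract (x * r j))
    (j : ℕ) : 0 ≤ ⌊x * r j⌋ ∧ ⌊x * r j⌋ ≤ ⌊x⌋ := by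
  refine ⟨Int.floor_nonneg.mpr (mul_nonneg hx (beta_nonneg hr0 hrs j)), Int.floor_le_floor ?_⟩
  calc x * r j ≤ x * 1 := by gcongr; exact beta_le_one hr0 hrs j
    _ = x := mul_one x

/-- `r_n = xⁿ · F_n(x)` with `F_n(y) = 1 − Σ_{j<n} d_j / y^{j+1}`. [folklore] -/
theorem beta_eq_pow_mul (hx : x ≠ 0) (hr0 : r 0 = 1)
    (hrs : ∀ j, r (j + 1) = Int.fract (x * r j)) :
    ∀ n, r n = x ^ n * (1 - ∑ j ∈ Finset.range n, (⌊x * r j⌋ : ℝ) / x ^ (j + 1))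
  | 0 => by simp [hr0]
  | n + 1 => by
    have ih := beta_eq_pow_mul hx hr0 hrs n
    rw [Finset.sum_range_succ, beta_succ hrs]
    generalize (⌊x * r n⌋ : ℝ) = d
    rw [ih]
    have : x ^ (n + 1) ≠ 0 := pow_ne_zero _ hx
    field_simp
    ring

/-- `0 ≤ F_n(x)` and `F_n(x) < x^{−n}` for `n ≥ 1`. [folklore] -/
theorem betaF_self_bounds (hx : 0 < x) (hr0 : r 0 = 1)
    (hrs : ∀ j, r (j + 1) = Int.fract (x * r j)) {n : ℕ} (hn : 1 ≤ n) :
    0 ≤ 1 - ∑ j ∈ Finset.range n, (⌊x * r j⌋ : ℝ) / x ^ (j + 1) ∧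
      1 - ∑ j ∈ Finset.range n, (⌊x * r j⌋ : ℝ) / x ^ (j + 1) < 1 / x ^ n := by
  have h := beta_eq_pow_mul hx.ne' hr0 hrs n
  constructor
  · have h0 := beta_nonneg hr0 hrs n
    rw [h] at h0
    exact (mul_nonneg_iff_of_pos_left (pow_pos hx n)).mp h0
  · obtain ⟨m, rfl⟩ : ∃ m, n = m + 1 := ⟨n - 1, by omega⟩
    have h1 := beta_succ_lt_one hrs m
    rw [h] at h1
    rw [lt_div_iff₀ (pow_pos hx _)]
    linarith [mul_comm (x ^ (m + 1))
      (1 - ∑ j ∈ Finset.range (m + 1), (⌊x * r j⌋ : ℝ) / x ^ (j + 1))]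

/-- Monotonicity in the variable: for `0 < y ≤ x` and `n ≥ 1`,
`F_n(y) ≤ F_n(x) − d_0 (1/y − 1/x)`. [folklore] -/
theorem betaF_le (hx : 0 ≤ x) (hr0 : r 0 = 1) (hrs : ∀ j, r (j + 1) = Int.fract (x * r j))
    {y : ℝ} (hy : 0 < y) (hyx : y ≤ x) {n : ℕ} (hn : 1 ≤ n) :
    1 - ∑ j ∈ Finset.range n, (⌊x * r j⌋ : ℝ) / y ^ (j + 1) ≤
      (1 - ∑ j ∈ Finset.range n, (⌊x * r j⌋ : ℝ) / x ^ (j + 1)) - ⌊x⌋ * (1 / y - 1 / x) := by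
  have hterm : ∀ j ∈ Finset.range n,
      0 ≤ (⌊x * r j⌋ : ℝ) / y ^ (j + 1) - (⌊x * r j⌋ : ℝ) / x ^ (j + 1) := by
    intro j _
    have hd : (0 : ℝ) ≤ ⌊x * r j⌋ := by exact_mod_cast (betaDigit_mem hx hr0 hrs j).1
    have : (⌊x * r j⌋ : ℝ) / x ^ (j + 1) ≤ (⌊x * r j⌋ : ℝ) / y ^ (j + 1) := by
      apply div_le_div_of_nonneg_left hd (pow_pos hy _)
      exact pow_le_pow_left₀ hy.le hyx _
    linarith
  have h0 : (0 : ℕ) ∈ Finset.range n := Finset.mem_range.mpr (by omega)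
  have hsingle := Finset.single_le_sum hterm h0
  simp only [zero_add, pow_one, hr0, mul_one] at hsingle
  rw [Finset.sum_sub_distrib] at hsingle
  have e : (⌊x⌋ : ℝ) * (1 / y - 1 / x) = (⌊x⌋ : ℝ) / y - (⌊x⌋ : ℝ) / x := by ring
  rw [e]
  linarith

/-- ROOT: for `x > 1` and `n ≥ 2`, `F_n` has a zero `ρ` with `x − x²/xⁿ ≤ ρ ≤ x` (IVT:
`F_n(x) ∈ [0, x^{-n})` and `F_n(x − δ) ≤ F_n(x) − ⌊x⌋ δ/x² < 0` for `δ = x²/xⁿ`). [folklore] -/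
theorem exists_root_betaF (hx1 : 1 < x) (hr0 : r 0 = 1)
    (hrs : ∀ j, r (j + 1) = Int.fract (x * r j)) {n : ℕ} (hn : 2 ≤ n) :
    ∃ ρ : ℝ, x - x ^ 2 / x ^ n ≤ ρ ∧ ρ ≤ x ∧ 0 < ρ ∧
      1 - ∑ j ∈ Finset.range n, (⌊x * r j⌋ : ℝ) / ρ ^ (j + 1) = 0 := by
  have hx0 : 0 < x := by linarith
  set F : ℝ → ℝ := fun y => 1 - ∑ j ∈ Finset.range n, (⌊x * r j⌋ : ℝ) / y ^ (j + 1) with hF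
  set δ : ℝ := x ^ 2 / x ^ n with hδ
  have hδpos : 0 < δ := by positivity
  have hδle : δ ≤ 1 := by
    rw [hδ, div_le_one (pow_pos hx0 n)]
    exact pow_le_pow_right₀ hx1.le hn
  set y : ℝ := x - δ with hy
  have hy0 : 0 < y := by linarith
  have hyx : y ≤ x := by linarith
  have hFy : F y < 0 := by
    have hmono := betaF_le hx0.le hr0 hrs hy0 hyx (n := n) (by omega)
    have hd0 : (1 : ℝ) ≤ ⌊x⌋ := by
      have : (1 : ℤ) ≤ ⌊x⌋ := Int.le_floor.mpr (by exact_mod_cast hx1.le)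
      exact_mod_cast this
    have hFx := (betaF_self_bounds hx0 hr0 hrs (n := n) (by omega)).2
    have hgap : 1 / x ^ n ≤ 1 / y - 1 / x := by
      have e1 : 1 / y - 1 / x = (x - y) / (y * x) := by
        field_simp
      have e2 : x - y = δ := by rw [hy]; ring
      rw [e1, e2, div_le_div_iff₀ (pow_pos hx0 n) (mul_pos hy0 hx0)]
      have e3 : δ * x ^ n = x ^ 2 := by
        rw [hδ]; field_simp
      rw [e3, one_mul, sq]
      exact mul_le_mul_of_nonneg_right hyx hx0.le
    have : 1 * (1 / x ^ n) ≤ (⌊x⌋ : ℝ) * (1 / y - 1 / x) :=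
      mul_le_mul hd0 hgap (by positivity) (by linarith)
    show 1 - ∑ j ∈ Finset.range n, (⌊x * r j⌋ : ℝ) / y ^ (j + 1) < 0
    linarith
  have hFx0 : 0 ≤ F x := (betaF_self_bounds hx0 hr0 hrs (n := n) (by omega)).1
  have hcont : ContinuousOn F (Set.Icc y x) := by
    apply ContinuousOn.sub continuousOn_const
    apply continuousOn_finsetSum
    intro j _
    apply ContinuousOn.div continuousOn_const (continuousOn_pow _)
    intro z hz
    exact pow_ne_zero _ (lt_of_lt_of_le hy0 hz.1).ne'
  have h0mem : (0 : ℝ) ∈ Set.Icc (F y) (F x) := ⟨hFy.le, hFx0⟩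
  obtain ⟨ρ, ⟨hρ1, hρ2⟩, hρ⟩ := intermediate_value_Icc hyx hcont h0mem
  exact ⟨ρ, hρ1, hρ2, lt_of_lt_of_le hy0 hρ1, hρ⟩

/-- The β-expansion polynomial `P_n = Σ_{m ≤ n} c_m X^m`, `c_n = 1`, `c_m = −d_{n−1−m}` (`m < n`):
its coefficients. [folklore] -/
theorem coeff_betaPoly (x : ℝ) (r : ℕ → ℝ) (n m : ℕ) :
    (∑ k ∈ Finset.range (n + 1),
        Polynomial.C (if k = n then (1 : ℤ) else -⌊x * r (n - 1 - k)⌋) * Polynomial.X ^ k).coeff m =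
      if m < n + 1 then (if m = n then (1 : ℤ) else -⌊x * r (n - 1 - m)⌋) else 0 := by
  simp only [Polynomial.finsetSum_coeff, Polynomial.coeff_C_mul_X_pow]
  rw [Finset.sum_ite_eq]
  simp only [Finset.mem_range]

/-- `P_n ≠ 0`, `deg P_n ≤ n`, naive height `≤ max(1, ⌊x⌋)` (for `x ≥ 0`). [folklore] -/
theorem betaPoly_clause (hx : 0 ≤ x) (hr0 : r 0 = 1)
    (hrs : ∀ j, r (j + 1) = Int.fract (x * r j)) (n : ℕ) :
    (∑ k ∈ Finset.range (n + 1),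
        Polynomial.C (if k = n then (1 : ℤ) else -⌊x * r (n - 1 - k)⌋) * Polynomial.X ^ k) ≠ 0 ∧
    (∑ k ∈ Finset.range (n + 1),
        Polynomial.C (if k = n then (1 : ℤ) else -⌊x * r (n - 1 - k)⌋) * Polynomial.X ^ k).natDegree
      ≤ n ∧
    ∀ m, |(∑ k ∈ Finset.range (n + 1),
        Polynomial.C (if k = n then (1 : ℤ) else -⌊x * r (n - 1 - k)⌋) * Polynomial.X ^ k).coeff m|
      ≤ max 1 ⌊x⌋ := by
  refine ⟨?_, ?_, ?_⟩
  · intro h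
    have := coeff_betaPoly x r n n
    rw [h, Polynomial.coeff_zero] at this
    simp at this
  · rw [Polynomial.natDegree_le_iff_coeff_eq_zero]
    intro m hm
    rw [coeff_betaPoly, if_neg]
    omega
  · intro m
    rw [coeff_betaPoly]
    split_ifs with h h'
    · simp
    · rw [abs_neg, abs_of_nonneg (betaDigit_mem hx hr0 hrs _).1]
      exact (betaDigit_mem hx hr0 hrs _).2.trans (le_max_right _ _)
    · simp

/-- Evaluation at a real point: `P_n(ρ) = ρⁿ F_n(ρ)` (`ρ ≠ 0`). [folklore] -/
theorem aeval_betaPoly (x : ℝ) (r : ℕ → ℝ) (n : ℕ) {ρ : ℝ} (hρ : ρ ≠ 0) :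
    Polynomial.aeval ρ (∑ k ∈ Finset.range (n + 1),
        Polynomial.C (if k = n then (1 : ℤ) else -⌊x * r (n - 1 - k)⌋) * Polynomial.X ^ k) =
      ρ ^ n * (1 - ∑ j ∈ Finset.range n, (⌊x * r j⌋ : ℝ) / ρ ^ (j + 1)) := by
  simp only [map_sum, map_mul, Polynomial.aeval_C, Polynomial.aeval_X_pow]
  simp only [algebraMap_int_eq, eq_intCast]
  rw [Finset.sum_range_succ]
  have hlast : ((if n = n then (1 : ℤ) else -⌊x * r (n - 1 - n)⌋ : ℤ) : ℝ) * ρ ^ n = ρ ^ n := by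
    simp
  rw [hlast]
  have hsum : ∑ k ∈ Finset.range n,
      ((if k = n then (1 : ℤ) else -⌊x * r (n - 1 - k)⌋ : ℤ) : ℝ) * ρ ^ k =
      -∑ j ∈ Finset.range n, (⌊x * r j⌋ : ℝ) * (ρ ^ n / ρ ^ (j + 1)) := by
    rw [← Finset.sum_range_reflect (fun j => (⌊x * r j⌋ : ℝ) * (ρ ^ n / ρ ^ (j + 1))) n,
      ← Finset.sum_neg_distrib]
    apply Finset.sum_congr rfl
    intro k hk
    have hk' : k < n := Finset.mem_range.mp hk
    rw [if_neg (by omega : k ≠ n)]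
    have e : ρ ^ n / ρ ^ (n - 1 - k + 1) = ρ ^ k := by
      rw [show n - 1 - k + 1 = n - k by omega, div_eq_mul_inv,
        ← pow_sub₀ ρ hρ (by omega : n - k ≤ n), show n - (n - k) = k by omega]
    push_cast
    rw [e]
    ring
  rw [hsum, mul_sub, mul_one, Finset.mul_sum]
  have hre : ∑ j ∈ Finset.range n, (⌊x * r j⌋ : ℝ) * (ρ ^ n / ρ ^ (j + 1)) =
      ∑ j ∈ Finset.range n, ρ ^ n * ((⌊x * r j⌋ : ℝ) / ρ ^ (j + 1)) :=
    Finset.sum_congr rfl (fun j _ => by ring)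
  rw [hre]
  ring

end Beta

/-- **Bounded-height algebraic approximations from β-expansions**: for `1 < x < 4` and `n ≥ 2`
there is a real root `ρ` of a non-zero integer polynomial of degree `≤ n` and naive height `≤ 3`
with `|ρ − x| ≤ x²/xⁿ` — in the exact shape of the crux's per-coordinate clause. [folklore] -/
theorem exists_clause_three_near {x : ℝ} (hx1 : 1 < x) (hx4 : x < 4) {n : ℕ} (hn : 2 ≤ n) :
    ∃ ρ : ℝ, |ρ - x| ≤ x ^ 2 / x ^ n ∧
      ∃ P : Polynomial ℤ, P ≠ 0 ∧ P.natDegree ≤ n ∧ (∀ k, |P.coeff k| ≤ ((3 : ℕ) : ℤ)) ∧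
        Polynomial.aeval (ρ : ℂ) P = 0 := by
  -- the greedy remainder sequence, by recursion (no definition needed)
  let r : ℕ → ℝ := fun m => Nat.rec (motive := fun _ => ℝ) 1 (fun _ ih => Int.fract (x * ih)) m
  have hr0 : r 0 = 1 := rfl
  have hrs : ∀ j, r (j + 1) = Int.fract (x * r j) := fun j => rfl
  have hx0 : 0 ≤ x := by linarith
  obtain ⟨ρ, hρ1, hρ2, hρ0, hF⟩ := exists_root_betaF hx1 hr0 hrs hn
  obtain ⟨hP0, hdeg, hcoeff⟩ := betaPoly_clause hx0 hr0 hrs n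
  refine ⟨ρ, ?_, _, hP0, hdeg, ?_, ?_⟩
  · have : 0 < x ^ 2 / x ^ n := by positivity
    rw [abs_sub_le_iff]
    constructor <;> linarith
  · intro k
    refine (hcoeff k).trans ?_
    have : ⌊x⌋ < 4 := Int.floor_lt.mpr (by exact_mod_cast hx4)
    push_cast
    exact max_le (by norm_num) (by omega)
  · have h : Polynomial.aeval ρ (∑ k ∈ Finset.range (n + 1),
        Polynomial.C (if k = n then (1 : ℤ) else -⌊x * r (n - 1 - k)⌋) * Polynomial.X ^ k) = 0 := by
      rw [aeval_betaPoly x r n hρ0.ne', hF, mul_zero]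
    rw [show (ρ : ℂ) = algebraMap ℝ ℂ ρ from rfl, Polynomial.aeval_algebraMap_apply, h, map_zero]

/-- `x²/xⁿ ≤ 16·e^{−n}` for `e ≤ x < 4`. [folklore] -/
theorem sq_div_pow_le {x : ℝ} (hxe : Real.exp 1 ≤ x) (hx4 : x < 4) (n : ℕ) :
    x ^ 2 / x ^ n ≤ 16 * Real.exp (-(n : ℝ)) := by
  have hx0 : 0 < x := lt_of_lt_of_le (Real.exp_pos 1) hxe
  have h1 : x ^ 2 ≤ 16 := by nlinarith
  have h2 : Real.exp (n : ℝ) ≤ x ^ n := by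
    rw [← mul_one (n : ℝ), Real.exp_nat_mul]
    exact pow_le_pow_left₀ (Real.exp_pos 1).le hxe n
  rw [Real.exp_neg, div_le_iff₀ (pow_pos hx0 n)]
  calc x ^ 2 ≤ 16 := h1
    _ = 16 * (Real.exp (n : ℝ))⁻¹ * Real.exp (n : ℝ) := by
        rw [mul_assoc, inv_mul_cancel₀ (Real.exp_pos _).ne', mul_one]
    _ ≤ 16 * (Real.exp (n : ℝ))⁻¹ * x ^ n := by gcongr

end EPiSimultaneousType

end Summit.Schanuel.Schanuel.Theorems

end
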